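import Literature.NumberTheory.LFunctions.ModifiedGRHOfGeneralizedRH
import Literature.NumberTheory.LFunctions.SiegelZerosLargePrimeGaps
import Literature.NumberTheory.LFunctions.SiegelZerosPrimeTuples
import Literature.Barriers.Parity.SiegelZeroDichotomyNoSiegelZeros
import HarnessLib

/-!
# Landau–Siegel zeros under the LOCAL hypothesis «only real zeros near `s = 1`»
# (Basak–Thorner–Zaharescu, *Algebra & Number Theory* 20 (2026) 209–217)

Topic `Literature/NumberTheory/LFunctions` (namespace `Literature.NumberTheory.LFunctions`, paper
vocabulary in the sub-namespace `BasakThornerZaharescu2026`). Typed for the cell `parity-realchar`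
(SIEGEL INSTRUMENT, deliverable (3) «illusory-world conditionals», direction II: an EXIT
«X ⇒ no Siegel zeros», next to Sarnak–Zaharescu's Hypothesis H of
`ModifiedGRHLOneLowerBounds.lean`). Source: D. Basak, J. Thorner, A. Zaharescu, *Remarks on
Landau–Siegel zeros*, Algebra & Number Theory **20**:1 (2026) 209–217, doi:10.2140/ant.2026.20.209
(PUBLISHED), held as arXiv:2404.16003 (`paper:arxiv-2404.16003`, §1 pp. 2–3, §2 (2.1), §4).

## What the source says (verbatim where it matters)

* §1: "Define `𝒮 = {χ (mod q_χ) : χ primitive and real}`." "Let Hypothesis H denote the hypothesis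
  that if `χ ∈ 𝒮`, then all zeros of `L(s, χ)` lie on `Re(s) = 1/2` or `Im(s) = 0`. [...] Under
  Hypothesis H, the work of Sarnak and Zaharescu [SZ2002] implies [...]: for all `ε > 0`, there
  exists an effectively computable constant `c₃(ε) > 0` such that
  `#{χ ∈ 𝒮 : q_χ ≥ c₃(ε) and L(s, χ) has a real zero in [1 − (log q_χ)^{−ε}, 1)} ≤ 1.` [...] Here,
  we will use Turán's power sum method to prove that [this] holds under a much weaker hypothesis.
  In order to state our hypothesis, we fix `0 < δ < 1/10`."
* **Hypothesis `H_δ`.** The held corpus-TeX copy drops the body of the `hypothesis` environment;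
  the statement is transcribed from the paper's own restatement in §4 (Theorem 4.1 with `m = 2`,
  "Remark 4.2. Theorem 4.1 recovers Theorem 1.1 when `m = 2`": "Assume that if `ν ∈ 𝒮_m`, then all
  zeros of `L(s, ν)` in the disk `|z − 1| < δ` are real") and from its use in §2 ("We assume `H_δ`,
  which implies that `L(s, χ₁)`, `L(s, χ₂)`, and `L(s, ψ)` have no non-real zeros in the disk
  `|z − 1| < δ`"), consistent with the abstract ("if each `L`-function in the family has only real
  zeros in a fixed yet arbitrarily small neighborhood of `s = 1`"). So: **`H_δ`: for every `χ ∈ 𝒮`,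
  every zero of `L(s, χ)` in the open disk `|s − 1| < δ` is real.**
* **Theorem 1.1.** "Fix `0 < δ < 1/10`. If `H_δ` is true, then for all `ε > 0`, there exists an
  effectively computable constant `q₀ = q₀(δ, ε) > 0` such that
  `#{χ ∈ 𝒮 : q_χ ≥ q₀ and L(s, χ) has a real zero in [1 − (log q_χ)^{−ε}, 1)} ≤ 1.`"
  "Remark 1.2. Our proof provides an explicit permissible expression for `q₀`. See (2.1)." and §2:
  "It suffices to let `0 < ε < 1`. We define (2.1) `q₀ = exp(exp(10 000/(δ³ ε²)))`."
* "Remark 1.3. It follows from Heath-Brown's zero density estimate in [HB] that if the `χ ∈ 𝒮` are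
  ordered by conductor `q_χ`, then a density 1 subset of `χ ∈ 𝒮` satisfy `H_δ`. In contrast,
  Hypothesis H in [SZ2002] has not been verified for any nontrivial `χ ∈ 𝒮` yet."
* **Corollary 1.4.** "Fix `0 < δ < 1/10`, and assume that `H_δ` is true. For all `ε > 0`, there
  exists an ineffective constant `c(δ, ε) > 0` such that if `χ ∈ 𝒮` and
  `σ ≥ 1 − c(δ, ε)(log q_χ)^{−ε}`, then `L(σ, χ) ≠ 0`."
* §4: Theorem 4.1 (characters of order dividing `m`, at most one exceptional class `[χ] = {χ, χ̄}`;
  `q₀(δ, ε, m)` not made explicit) and Theorem 4.3 (Hecke–Maaß forms, symmetric-square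
  `L`-functions) — INDEX ONLY, not typed (Theorem 4.1's threshold is not printed; Theorem 4.3's
  objects have no vocabulary in the tree).

## How it is typed

* `BasakThornerZaharescu2026.LocalRealZeros δ` — Hypothesis `H_δ`, a PREDICATE in `δ` (closed for
  each `δ`; never asserted, no `_holds`): for every `q ≥ 1` and every primitive quadratic `χ mod q`
  (Mathlib `IsQuadratic` = values in `{0, ±1}`; `q = 1` is `ζ`, as in the paper's `𝒮` and as in
  the tree's `ModifiedGRH`), every zero `s` of `χ.LFunction` with `‖s − 1‖ < δ` has `Im s = 0`.
* `BasakThornerZaharescu2026.threshold δ ε = exp(exp(10⁴/(δ³ε²)))` — the printed `q₀` (2.1).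
* `basakThornerZaharescu2026_theorem11` — NAMED FACT, Theorem 1.1 with the EXPLICIT `q₀` of (2.1)
  (for `0 < ε < 1`, the paper's standing reduction). "At most one `χ ∈ 𝒮`" across moduli is
  rendered as two clauses with no heterogeneous equality of characters (the idiom of
  `Literature.Barriers.RiemannHypothesis.Iwaniec2006_landauRepulsion`): (a) two characters to
  DIFFERENT moduli `q₁ ≠ q₂`, both `≥ q₀`, do not both have a real zero in their intervals; (b) two
  DISTINCT characters to the SAME modulus `q ≥ q₀` do not both. "Real zero in `[1 − (log q)^{−ε}, 1)`"
  = a real `β < 1` with `L(β, χ) = 0` and `1 − (log q)^{−ε} ≤ β`.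
* `basakThornerZaharescu2026_corollary14` — NAMED FACT, Corollary 1.4, for `q_χ ≥ 3` (i.e. `χ`
  non-trivial, the case intended: for the trivial character the printed inequality
  `σ ≥ 1 − c (log 1)^{−ε}` is not meaningful); WEAKER than print by that restriction.
* PROVED: `LocalRealZeros.anti` (monotone in `δ`); `LocalRealZeros.of_modifiedGRH` and
  `.of_localModifiedGRH` (Sarnak–Zaharescu's H, and even the local H* of their Theorem 4, imply
  `H_δ` for every `δ ≤ 1/2` — the paper's "much weaker hypothesis"); `.of_generalizedRiemannHypothesis`;
  and, modulo Corollary 1.4: `LocalRealZeros.not_polylogExceptionalZeros` (¬ Ford's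
  `PolylogExceptionalZeros k`, every `k > 0`), `LocalRealZeros.not_strongSiegelZeros` (¬ Wright's
  `StrongSiegelZeros A`, `A ≥ 0`), `LocalRealZeros.not_unboundedSiegelZeros` and
  **`LocalRealZeros.noSiegelZeros`** (`H_δ` ⇒ the tree's open `NoSiegelZeros`, rh.S34, through the
  PROVED bridge `noSiegelZeros_of_not_unboundedSiegelZeros`) — a new printed EXIT: «no primitive real
  `L`-function has a NON-REAL zero within `δ` of `s = 1`» already excludes Siegel zeros.

LABEL (cell rule): instrument / statement layer. WHAT THIS IS NOT: no claim that `H_δ` holds (it is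
open for every single non-trivial `χ`, Remark 1.3 is a density statement); nothing here bears on
the parity summit; the certified tables of the cell do not interact with `H_δ`.

## References

* [BasakThornerZaharescu2026] D. Basak, J. Thorner, A. Zaharescu, *Remarks on Landau–Siegel zeros*,
  Algebra & Number Theory 20 (2026) 209–217 — §1 Hypothesis `H_δ`, Theorem 1.1, Remarks 1.2–1.3,
  Corollary 1.4; §2 (2.1); §4 Theorems 4.1, 4.3 (index only).
* [SarnakZaharescu2002] P. Sarnak, A. Zaharescu, Duke Math. J. 111 (2002) — Hypothesis H / H*
  (tree: `ModifiedGRH`, `LocalModifiedGRH`).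
* [TaoTeravainen2021] Definition 1.4 (`IsSiegelZero`, `UnboundedSiegelZeros`).
* [Ford2019LargePrimeGaps] §1 (tree: `Ford2020.PolylogExceptionalZeros`); [Wright2023PrimeTuplesSiegel] §3
  (tree: `WrightPrimeTuples.StrongSiegelZeros`) — the hypotheses refuted under `H_δ`.
-/

noncomputable section

open Complex

namespace Literature.NumberTheory.LFunctions

open Literature.Barriers.Parity

namespace BasakThornerZaharescu2026

/-- **Hypothesis `H_δ`** (Basak–Thorner–Zaharescu): for every primitive real Dirichlet character
`χ` (to any modulus `q ≥ 1`; `q = 1` is `ζ`), every zero of `L(s, χ)` in the open disk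
`|s − 1| < δ` is REAL. A PREDICATE in `δ` (a closed hypothesis for each `δ`), never asserted; the
paper fixes `0 < δ < 1/10`. (Transcribed from §4 Theorem 4.1 with `m = 2` / Remark 4.2 and §2, the
held TeX copy dropping the display of §1 — see the module docstring.)
[cite: BasakThornerZaharescu2026, §1 Hypothesis H_δ; §4 Theorem 4.1 and Remark 4.2] -/
def LocalRealZeros (δ : ℝ) : Prop :=
  ∀ (q : ℕ) [NeZero q] (χ : DirichletCharacter ℂ q), χ.IsQuadratic → χ.IsPrimitive →
    ∀ s : ℂ, χ.LFunction s = 0 → ‖s - 1‖ < δ → s.im = 0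

/-- The printed threshold `q₀ = q₀(δ, ε) = exp(exp(10 000/(δ³ ε²)))` of (2.1) ("Remark 1.2. Our proof
provides an explicit permissible expression for `q₀`"). [cite: BasakThornerZaharescu2026, §2 (2.1)] -/
def threshold (δ ε : ℝ) : ℝ :=
  Real.exp (Real.exp (10000 / (δ ^ 3 * ε ^ 2)))

/-- `H_δ` is monotone: a larger disk is a stronger hypothesis. [cite: BasakThornerZaharescu2026, §1 Hypothesis H_δ] -/
theorem LocalRealZeros.anti {δ δ' : ℝ} (hle : δ' ≤ δ) (h : LocalRealZeros δ) :
    LocalRealZeros δ' :=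
  fun q _ χ hquad hprim s hs hdist => h q χ hquad hprim s hs (lt_of_lt_of_le hdist hle)

/-- A zero on the critical line `Re s = 1/2` is at distance `≥ 1/2` from `s = 1`. [folklore] -/
private theorem half_le_norm_sub_one_of_re_eq_half {s : ℂ} (hs : s.re = 1 / 2) :
    (1 : ℝ) / 2 ≤ ‖s - 1‖ := by
  have h1 : |(s - 1).re| ≤ ‖s - 1‖ := Complex.abs_re_le_norm (s - 1)
  have h2 : (s - 1).re = -(1 / 2) := by simp [hs]; norm_num
  rw [h2, abs_neg, abs_of_pos (by norm_num : (0 : ℝ) < 1 / 2)] at h1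
  exact h1

/-- **Sarnak–Zaharescu's Hypothesis H implies `H_δ` for every `δ ≤ 1/2`** ("a much weaker
hypothesis", §1): a zero in the disk `|s − 1| < δ ≤ 1/2` cannot lie on `Re s = 1/2`, so under H it is
real. [cite: BasakThornerZaharescu2026, §1 (comparison with Hypothesis H)]
[cite: SarnakZaharescu2002, Hypothesis H (p. 496)] -/
theorem LocalRealZeros.of_modifiedGRH (hH : ModifiedGRH) {δ : ℝ} (hδ : δ ≤ 1 / 2) :
    LocalRealZeros δ := by
  intro q _ χ hquad hprim s hs hdist
  rcases hH q χ hquad hprim s hs with him | hre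
  · exact him
  · exact absurd (lt_of_lt_of_le hdist hδ) (not_lt.mpr (half_le_norm_sub_one_of_re_eq_half hre))

/-- **Even the LOCAL Hypothesis H* (zeros with `|Im s| ≤ 2` real or critical, Sarnak–Zaharescu's
hypothesis for their Theorem 4) implies `H_δ` for `δ ≤ 1/2`**: a zero with `|s − 1| < δ` has
`|Im s| < 1/2 ≤ 2`. [cite: BasakThornerZaharescu2026, §1 (comparison with Hypothesis H)]
[cite: SarnakZaharescu2002, Hypothesis H* (p. 498)] -/
theorem LocalRealZeros.of_localModifiedGRH (hH : LocalModifiedGRH) {δ : ℝ} (hδ : δ ≤ 1 / 2) :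
    LocalRealZeros δ := by
  intro q _ χ hquad hprim s hs hdist
  have him2 : |s.im| ≤ 2 := by
    have h1 : |(s - 1).im| ≤ ‖s - 1‖ := Complex.abs_im_le_norm (s - 1)
    have h2 : (s - 1).im = s.im := by simp
    rw [h2] at h1
    linarith
  rcases hH q χ hquad hprim s hs him2 with him | hre
  · exact him
  · exact absurd (lt_of_lt_of_le hdist hδ) (not_lt.mpr (half_le_norm_sub_one_of_re_eq_half hre))

/-- `GRH ⇒ H_δ` (`δ ≤ 1/2`), through the tree's PROVED `GRH ⇒ Hypothesis H`
(`ModifiedGRH.of_generalizedRiemannHypothesis`). [cite: BasakThornerZaharescu2026, §1 (comparison with Hypothesis H)] -/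
theorem LocalRealZeros.of_generalizedRiemannHypothesis (hGRH : GeneralizedRiemannHypothesis)
    {δ : ℝ} (hδ : δ ≤ 1 / 2) : LocalRealZeros δ :=
  LocalRealZeros.of_modifiedGRH (ModifiedGRH.of_generalizedRiemannHypothesis hGRH) hδ

end BasakThornerZaharescu2026

open BasakThornerZaharescu2026

/-- **Basak–Thorner–Zaharescu 2026, Theorem 1.1 (NAMED FACT, as printed, with the explicit `q₀` of
(2.1)).** "Fix `0 < δ < 1/10`. If `H_δ` is true, then for all `ε > 0`, there exists an effectively
computable constant `q₀ = q₀(δ, ε) > 0` such that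
`#{χ ∈ 𝒮 : q_χ ≥ q₀ and L(s, χ) has a real zero in [1 − (log q_χ)^{−ε}, 1)} ≤ 1`", with
`q₀ = exp(exp(10 000/(δ³ε²)))` permissible for `0 < ε < 1` (Remark 1.2, (2.1), "It suffices to let
`0 < ε < 1`"). Rendered as: for primitive quadratic `χ₁ mod q₁`, `χ₂ mod q₂` with
`q₁, q₂ ≥ q₀(δ, ε)` that are distinct — (a) `q₁ ≠ q₂`, or (b) `q₁ = q₂` and `χ₁ ≠ χ₂` — and real
zeros `β₁ < 1` of `L(s, χ₁)`, `β₂ < 1` of `L(s, χ₂)`: `β₁ < 1 − (log q₁)^{−ε}` or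
`β₂ < 1 − (log q₂)^{−ε}`. Unproved here (Turán power sums, §§2–3).
[cite: BasakThornerZaharescu2026, Theorem 1.1, Remark 1.2 and (2.1)] -/
def basakThornerZaharescu2026_theorem11 : Prop :=
  ∀ δ : ℝ, 0 < δ → δ < 1 / 10 → LocalRealZeros δ → ∀ ε : ℝ, 0 < ε → ε < 1 →
    (∀ (q₁ q₂ : ℕ) [NeZero q₁] [NeZero q₂] (χ₁ : DirichletCharacter ℂ q₁)
        (χ₂ : DirichletCharacter ℂ q₂), q₁ ≠ q₂ → threshold δ ε ≤ q₁ → threshold δ ε ≤ q₂ →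
        χ₁.IsQuadratic → χ₁.IsPrimitive → χ₂.IsQuadratic → χ₂.IsPrimitive →
        ∀ β₁ β₂ : ℝ, χ₁.LFunction β₁ = 0 → χ₂.LFunction β₂ = 0 → β₁ < 1 → β₂ < 1 →
          β₁ < 1 - Real.log q₁ ^ (-ε) ∨ β₂ < 1 - Real.log q₂ ^ (-ε)) ∧
    (∀ (q : ℕ) [NeZero q] (χ₁ χ₂ : DirichletCharacter ℂ q), χ₁ ≠ χ₂ → threshold δ ε ≤ q →
        χ₁.IsQuadratic → χ₁.IsPrimitive → χ₂.IsQuadratic → χ₂.IsPrimitive →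
        ∀ β₁ β₂ : ℝ, χ₁.LFunction β₁ = 0 → χ₂.LFunction β₂ = 0 → β₁ < 1 → β₂ < 1 →
          β₁ < 1 - Real.log q ^ (-ε) ∨ β₂ < 1 - Real.log q ^ (-ε))

/-- **Basak–Thorner–Zaharescu 2026, Corollary 1.4 (NAMED FACT, as printed; ineffective).** "Fix
`0 < δ < 1/10`, and assume that `H_δ` is true. For all `ε > 0`, there exists an ineffective constant
`c(δ, ε) > 0` such that if `χ ∈ 𝒮` and `σ ≥ 1 − c(δ, ε)(log q_χ)^{−ε}`, then `L(σ, χ) ≠ 0`."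
Rendered for non-trivial `χ` (`q_χ ≥ 3`), WEAKER than print by that restriction. "Immediate
corollary of Theorem 1.1" in print; kept as a separate named fact here.
[cite: BasakThornerZaharescu2026, Corollary 1.4] -/
def basakThornerZaharescu2026_corollary14 : Prop :=
  ∀ δ : ℝ, 0 < δ → δ < 1 / 10 → LocalRealZeros δ → ∀ ε : ℝ, 0 < ε →
    ∃ c : ℝ, 0 < c ∧ ∀ (q : ℕ) [NeZero q] (χ : DirichletCharacter ℂ q), 3 ≤ q →
      χ.IsQuadratic → χ.IsPrimitive →
      ∀ σ : ℝ, 1 - c * Real.log q ^ (-ε) ≤ σ → χ.LFunction σ ≠ 0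

/-! ### Consequences of Corollary 1.4 (PROVED modulo the named fact) -/

/-- For `q ≥ 3`, `1 < log q`. [folklore] -/
private theorem one_lt_log_of_three_le' {q : ℕ} (hq : 3 ≤ q) : 1 < Real.log q := by
  have hq3 : (3 : ℝ) ≤ (q : ℝ) := by exact_mod_cast hq
  have hlog3 : 1 < Real.log 3 := by
    have h := Real.exp_one_lt_d9
    rw [Real.lt_log_iff_exp_lt (by norm_num)]
    linarith
  exact lt_of_lt_of_le hlog3 (Real.log_le_log (by norm_num) hq3)

/-- **`H_δ` bounds the quality of Siegel zeros at large conductors** (modulo Corollary 1.4): with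
`ε = 1/2` the interval `[1 − 1/log q, 1)` is zero-free for every primitive quadratic `χ mod q` once
`c √(log q) ≥ 1`, hence `¬ UnboundedSiegelZeros` (Tao–Teräväinen's hypothesis of Siegel zeros of
unbounded quality). [cite: BasakThornerZaharescu2026, Corollary 1.4] [cite: TaoTeravainen2021, Definition 1.4] -/
theorem BasakThornerZaharescu2026.LocalRealZeros.not_unboundedSiegelZeros
    (h14 : basakThornerZaharescu2026_corollary14) {δ : ℝ} (hδ : 0 < δ) (hδ' : δ < 1 / 10)
    (hH : LocalRealZeros δ) : ¬ Summit.Parity.GeneralizedHardyLittlewood.UnboundedSiegelZeros := by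
  obtain ⟨c, hc, hzf⟩ := h14 δ hδ hδ' hH (1 / 2) (by norm_num)
  rw [not_unboundedSiegelZeros_iff_zeroFree]
  -- threshold: `log q ≥ L := max 1 (1/c²)`, so that `c (log q)^{-1/2} ≥ ... ` no: `(log q)^{-1/2} ≤ c`... we need
  -- `1/log q ≤ c (log q)^{-1/2}`, i.e. `(log q)^{-1/2} ≤ c`, i.e. `log q ≥ c^{-2}`.
  set L : ℝ := max 1 (c ^ (-(2 : ℝ))) with hLdef
  have hL1 : 1 ≤ L := le_max_left _ _
  have hLpos : 0 < L := by linarith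
  refine ⟨1, one_pos, ⌈Real.exp L⌉₊ + 3, fun q _ χ hq hprim hquad σ hσlo _hσ1 => ?_⟩
  have hq3 : 3 ≤ q := by omega
  have hlogq : L ≤ Real.log q := by
    have h1 : Real.exp L ≤ q := by
      have : (⌈Real.exp L⌉₊ : ℝ) ≤ q := by exact_mod_cast (show ⌈Real.exp L⌉₊ ≤ q by omega)
      exact le_trans (Nat.le_ceil _) this
    calc L = Real.log (Real.exp L) := (Real.log_exp L).symm
      _ ≤ Real.log q := Real.log_le_log (Real.exp_pos L) h1
  have hlogpos : 0 < Real.log q := lt_of_lt_of_le hLpos hlogq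
  have hsmall : Real.log q ^ (-(1 / 2 : ℝ)) ≤ c := by
    have h1 : Real.log q ^ (-(1 / 2 : ℝ)) ≤ L ^ (-(1 / 2 : ℝ)) :=
      Real.rpow_le_rpow_of_nonpos hLpos hlogq (by norm_num)
    have h2 : L ^ (-(1 / 2 : ℝ)) ≤ (c ^ (-(2 : ℝ))) ^ (-(1 / 2 : ℝ)) :=
      Real.rpow_le_rpow_of_nonpos (Real.rpow_pos_of_pos hc _) (le_max_right _ _) (by norm_num)
    have h3 : (c ^ (-(2 : ℝ))) ^ (-(1 / 2 : ℝ)) = c := by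
      rw [← Real.rpow_mul hc.le]; norm_num
    linarith [h1, h2, h3.le]
  -- `1/log q = (log q)^{-1/2} · (log q)^{-1/2} ≤ c (log q)^{-1/2}`
  have hkey : 1 / Real.log q ≤ c * Real.log q ^ (-(1 / 2 : ℝ)) := by
    have hsplit : 1 / Real.log q = Real.log q ^ (-(1 / 2 : ℝ)) * Real.log q ^ (-(1 / 2 : ℝ)) := by
      rw [← Real.rpow_add hlogpos, one_div, ← Real.rpow_neg_one]; norm_num
    rw [hsplit]
    exact mul_le_mul_of_nonneg_right hsmall (Real.rpow_nonneg hlogpos.le _)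
  have hσ : 1 - c * Real.log q ^ (-(1 / 2 : ℝ)) ≤ σ := by
    have : 1 / (1 * Real.log q) = 1 / Real.log q := by rw [one_mul]
    rw [this] at hσlo
    linarith
  exact hzf q χ hq3 hquad hprim σ hσ

/-- **EXIT: `H_δ` implies the tree's open no-Siegel-zeros statement `NoSiegelZeros` (rh.S34)**,
modulo Corollary 1.4: bounded quality at large conductors (`not_unboundedSiegelZeros`) and the
PROVED bridge `noSiegelZeros_of_not_unboundedSiegelZeros` (small conductors by continuity at
`s = 1`). In words: if no primitive real `L(s, χ)` has a NON-REAL zero within distance `δ` of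
`s = 1` (any fixed `δ ∈ (0, 1/10)`), then there are no Landau–Siegel zeros — next to the exits by
uniform abc (Granville–Stark), Brun–Titchmarsh with constant `< 2` (Motohashi; Granville) and weak
Goldbach (Friedlander–Iwaniec; Matomäki–Merikoski) already in the tree.
[cite: BasakThornerZaharescu2026, Corollary 1.4] -/
theorem BasakThornerZaharescu2026.LocalRealZeros.noSiegelZeros
    (h14 : basakThornerZaharescu2026_corollary14) {δ : ℝ} (hδ : 0 < δ) (hδ' : δ < 1 / 10)
    (hH : LocalRealZeros δ) : NoSiegelZeros :=
  noSiegelZeros_of_not_unboundedSiegelZeros (hH.not_unboundedSiegelZeros h14 hδ hδ')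

/-- **Sarnak–Zaharescu's Hypothesis H already gives `NoSiegelZeros`** (modulo Basak–Thorner–Zaharescu's
Corollary 1.4, via `H ⇒ H_{1/20}`) — an upgrade of `ModifiedGRH.landauSiegelZero_repulsion`
(`1 − β₁ ≫ (log q)^{−2−ε}` from Sarnak–Zaharescu's Theorem 1) to full exclusion.
[cite: BasakThornerZaharescu2026, Corollary 1.4] [cite: SarnakZaharescu2002, Hypothesis H (p. 496)] -/
theorem ModifiedGRH.noSiegelZeros_of_corollary14 (hH : ModifiedGRH)
    (h14 : basakThornerZaharescu2026_corollary14) : NoSiegelZeros :=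
  (LocalRealZeros.of_modifiedGRH hH (by norm_num : (1 / 20 : ℝ) ≤ 1 / 2)).noSiegelZeros h14
    (by norm_num) (by norm_num)

/-! ### Corollary 1.4 from Theorem 1.1 (appended 2026-08-26): the named fact
`basakThornerZaharescu2026_corollary14` DISCHARGED modulo `basakThornerZaharescu2026_theorem11`

"Our next result, which is ineffective, is an immediate corollary of Theorem 1.1" (§1). The kernel
argument: for `q ≥ q₀(δ, ε')` (`ε' = min(ε, 1/2) < 1`) every character WITHOUT a real zero in
`[1 − (log q)^{−ε'}, 1)` is zero-free there (and on `σ ≥ 1`); by Theorem 1.1 all characters WITH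
such a zero coincide (one modulus `q⋆`, one `χ⋆`), and `L(s, χ⋆)` — continuous and non-zero at
`s = 1` — is zero-free on some `(1 − r, ∞)`; the finitely many characters of modulus `< q₀` likewise,
with one `r` for all of them. The constant `c` is the minimum of `1`, `r (log q⋆)^{ε'}/2` and the
small-modulus constant — ineffective exactly where the paper says (the possible `χ⋆`). -/

/-- Finite uniformisation: if each index of a finite set admits a positive constant with a property
monotone under shrinking, one positive constant serves all indices. [folklore] -/
private theorem exists_pos_forall_mem_finset' {ι : Type*} (s : Finset ι) (P : ι → ℝ → Prop)
    (hmono : ∀ i c c', c' ≤ c → P i c → P i c') (h : ∀ i ∈ s, ∃ c : ℝ, 0 < c ∧ P i c) :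
    ∃ c : ℝ, 0 < c ∧ ∀ i ∈ s, P i c := by
  classical
  induction s using Finset.induction_on with
  | empty => exact ⟨1, one_pos, fun i hi => absurd hi (Finset.notMem_empty i)⟩
  | insert a s ha ih =>
    obtain ⟨c₁, hc₁, h₁⟩ := h a (Finset.mem_insert_self a s)
    obtain ⟨c₂, hc₂, h₂⟩ := ih fun i hi => h i (Finset.mem_insert_of_mem hi)
    refine ⟨min c₁ c₂, lt_min hc₁ hc₂, fun i hi => ?_⟩
    rcases Finset.mem_insert.mp hi with rfl | hi
    · exact hmono _ _ _ (min_le_left _ _) h₁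
    · exact hmono _ _ _ (min_le_right _ _) (h₂ i hi)

/-- A primitive character of modulus `q ≥ 2` is non-trivial. [folklore] -/
private theorem ne_one_of_isPrimitive' {q : ℕ} [NeZero q] (hq : 2 ≤ q)
    {χ : DirichletCharacter ℂ q} (hχ : χ.IsPrimitive) : χ ≠ 1 := by
  intro h1
  rw [DirichletCharacter.isPrimitive_def, h1, DirichletCharacter.conductor_one] at hχ
  omega

/-- `L(σ, χ) ≠ 0` for real `σ ≥ 1 − c (log q)^{−ε}` once `c (log q)^{−ε} < r` and `L(s, χ)` is
zero-free on the real half-line `σ > 1 − r`: the elementary step used three times below. [folklore] -/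
private theorem ne_zero_of_zeroFree_near_one {q : ℕ} [NeZero q] {χ : DirichletCharacter ℂ q}
    {r c ε σ : ℝ} (hzf : ∀ σ : ℝ, 1 - r < σ → χ.LFunction σ ≠ 0)
    (hc : c * Real.log q ^ (-ε) < r) (hσ : 1 - c * Real.log q ^ (-ε) ≤ σ) : χ.LFunction σ ≠ 0 :=
  hzf σ (by linarith)

/-- For a non-trivial character, `L(σ, χ) ≠ 0` on a real neighbourhood `(1 − r, ∞)` of `σ = 1`
(continuity at `1` and non-vanishing on `Re s ≥ 1`), packaged with the scale `(log q)^{ε}`: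
there is `c > 0` with `L(σ, χ) ≠ 0` for all `σ ≥ 1 − c' (log q)^{−ε}`, every `c' ≤ c`. [folklore] -/
private theorem exists_const_zeroFree {q : ℕ} [NeZero q] (hq : 2 ≤ q) (χ : DirichletCharacter ℂ q)
    (hχ : χ.IsPrimitive) (ε : ℝ) :
    ∃ c : ℝ, 0 < c ∧ ∀ c' : ℝ, c' ≤ c →
      ∀ σ : ℝ, 1 - c' * Real.log q ^ (-ε) ≤ σ → χ.LFunction σ ≠ 0 := by
  have hne : χ ≠ 1 := ne_one_of_isPrimitive' hq hχ
  have hcont : ContinuousAt χ.LFunction 1 :=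
    (DirichletCharacter.differentiableAt_LFunction χ 1 (Or.inr hne)).continuousAt
  have hne1 : χ.LFunction 1 ≠ 0 :=
    DirichletCharacter.LFunction_ne_zero_of_one_le_re χ (Or.inl hne) (by simp)
  have hev : ∀ᶠ s in nhds (1 : ℂ), χ.LFunction s ≠ 0 := hcont.eventually_ne hne1
  obtain ⟨r, hr, hball⟩ := Metric.eventually_nhds_iff.mp hev
  -- zero-free on the real half-line `σ > 1 - r`
  have hzf : ∀ σ : ℝ, 1 - r < σ → χ.LFunction σ ≠ 0 := by
    intro σ hσ
    rcases le_or_gt 1 σ with h1 | h1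
    · exact DirichletCharacter.LFunction_ne_zero_of_one_le_re χ (Or.inl hne) (by simpa using h1)
    · apply hball
      rw [Complex.dist_eq, show (σ : ℂ) - 1 = ((σ - 1 : ℝ) : ℂ) by push_cast; ring,
        Complex.norm_real, Real.norm_eq_abs, abs_sub_comm, abs_of_pos (by linarith)]
      linarith
  -- the scale: `c = r (log q)^{ε} / 2`, so that `c (log q)^{-ε} = r/2 < r`
  have hq1 : (1 : ℝ) < q := by exact_mod_cast (show 1 < q by omega)
  have hlogpos : 0 < Real.log q := Real.log_pos hq1
  have hpow : 0 < Real.log q ^ ε := Real.rpow_pos_of_pos hlogpos ε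
  have hpow' : 0 < Real.log q ^ (-ε) := Real.rpow_pos_of_pos hlogpos (-ε)
  refine ⟨r * Real.log q ^ ε / 2, by positivity, fun c' hc' σ hσ => ?_⟩
  have hprod : Real.log q ^ ε * Real.log q ^ (-ε) = 1 := by
    rw [← Real.rpow_add hlogpos, add_neg_cancel, Real.rpow_zero]
  have hcr : r * Real.log q ^ ε / 2 * Real.log q ^ (-ε) = r / 2 := by
    calc r * Real.log q ^ ε / 2 * Real.log q ^ (-ε)
        = r / 2 * (Real.log q ^ ε * Real.log q ^ (-ε)) := by ring
      _ = r / 2 := by rw [hprod, mul_one]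
  have hc'le : c' * Real.log q ^ (-ε) ≤ r / 2 := by
    calc c' * Real.log q ^ (-ε) ≤ r * Real.log q ^ ε / 2 * Real.log q ^ (-ε) :=
          mul_le_mul_of_nonneg_right hc' hpow'.le
      _ = r / 2 := hcr
  exact hzf σ (by linarith)

/-- **Corollary 1.4 FROM Theorem 1.1** (the paper's "immediate corollary", ineffective): the named
fact `basakThornerZaharescu2026_corollary14` holds modulo `basakThornerZaharescu2026_theorem11`.
[cite: BasakThornerZaharescu2026, Corollary 1.4] -/
theorem basakThornerZaharescu2026_corollary14_of_theorem11
    (h11 : basakThornerZaharescu2026_theorem11) : basakThornerZaharescu2026_corollary14 := by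
  classical
  intro δ hδ hδ' hH ε hε
  -- reduce to an exponent `ε' < 1`
  set ε' : ℝ := min ε (1 / 2) with hε'def
  have hε'pos : 0 < ε' := lt_min hε (by norm_num)
  have hε'lt : ε' < 1 := lt_of_le_of_lt (min_le_right _ _) (by norm_num)
  have hε'le : ε' ≤ ε := min_le_left _ _
  obtain ⟨hA, hB⟩ := h11 δ hδ hδ' hH ε' hε'pos hε'lt
  set Q₀ : ℝ := threshold δ ε' with hQ₀def
  set N : ℕ := ⌈Q₀⌉₊ + 3 with hNdef
  -- exceptional triples at large modulus
  let EXC : ∀ (q : ℕ), DirichletCharacter ℂ q → ℝ → Prop := fun q χ β =>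
    ∃ _ : NeZero q, Q₀ ≤ q ∧ χ.IsQuadratic ∧ χ.IsPrimitive ∧ χ.LFunction β = 0 ∧ β < 1 ∧
      1 - Real.log q ^ (-ε') ≤ β
  -- (i) small moduli: one constant for all `3 ≤ q < N`
  obtain ⟨c₁, hc₁, hsmall⟩ := exists_pos_forall_mem_finset' (Finset.Ico 3 N)
    (fun q c => ∀ _ : NeZero q, ∀ χ : DirichletCharacter ℂ q, χ.IsPrimitive →
      ∀ σ : ℝ, 1 - c * Real.log q ^ (-ε') ≤ σ → χ.LFunction σ ≠ 0)
    (fun q c c' hle hP inst χ hprim σ hσ => by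
      have hlog : 0 ≤ Real.log q ^ (-ε') := Real.rpow_nonneg (Real.log_natCast_nonneg q) _
      have : c' * Real.log q ^ (-ε') ≤ c * Real.log q ^ (-ε') := mul_le_mul_of_nonneg_right hle hlog
      exact hP inst χ hprim σ (by linarith))
    (fun q hq => by
      have hq3 : 3 ≤ q := (Finset.mem_Ico.mp hq).1
      haveI : NeZero q := ⟨by omega⟩
      -- uniform over the finitely many characters mod `q`
      obtain ⟨c, hc, h⟩ := exists_pos_forall_mem_finset' (Finset.univ : Finset (DirichletCharacter ℂ q))
        (fun χ c => χ.IsPrimitive → ∀ σ : ℝ, 1 - c * Real.log q ^ (-ε') ≤ σ → χ.LFunction σ ≠ 0)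
        (fun χ c c' hle hP hprim σ hσ => by
          have hlog : 0 ≤ Real.log q ^ (-ε') := Real.rpow_nonneg (Real.log_natCast_nonneg q) _
          have : c' * Real.log q ^ (-ε') ≤ c * Real.log q ^ (-ε') :=
            mul_le_mul_of_nonneg_right hle hlog
          exact hP hprim σ (by linarith))
        (fun χ _ => by
          by_cases hprim : χ.IsPrimitive
          · obtain ⟨c, hc, hz⟩ := exists_const_zeroFree (by omega) χ hprim ε'
            exact ⟨c, hc, fun _ σ hσ => hz c le_rfl σ hσ⟩
          · exact ⟨1, one_pos, fun h => absurd h hprim⟩)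
      exact ⟨c, hc, fun _ χ hprim => h χ (Finset.mem_univ χ) hprim⟩)
  -- (ii) the (at most one) exceptional character at large modulus
  obtain ⟨c₂, hc₂, hexc⟩ : ∃ c₂ : ℝ, 0 < c₂ ∧ ∀ (q : ℕ) (χ : DirichletCharacter ℂ q) (β : ℝ),
      EXC q χ β → ∀ _ : NeZero q, ∀ σ : ℝ, 1 - c₂ * Real.log q ^ (-ε') ≤ σ → χ.LFunction σ ≠ 0 := by
    by_cases hex : ∃ (q : ℕ) (χ : DirichletCharacter ℂ q) (β : ℝ), EXC q χ β
    · obtain ⟨q₀, χ₀, β₀, inst₀, hq₀, hquad₀, hprim₀, hz₀, hβ₀1, hβ₀⟩ := hex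
      have hq₀3 : 3 ≤ q₀ := by
        -- `Q₀ = exp(exp(…)) ≥ exp 0 = 1`… we only need `q₀ ≥ 2`; get `q₀ ≥ 3` from `Q₀ > e > 2`
        have h1 : (1 : ℝ) < Real.exp (10000 / (δ ^ 3 * ε' ^ 2)) := by
          have : (0 : ℝ) < 10000 / (δ ^ 3 * ε' ^ 2) := by positivity
          calc (1 : ℝ) = Real.exp 0 := (Real.exp_zero).symm
            _ < _ := Real.exp_lt_exp.mpr this
        have h2 : Real.exp 1 ≤ Q₀ := by
          rw [hQ₀def]; unfold threshold
          exact Real.exp_le_exp.mpr h1.le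
        have h3 : (2 : ℝ) < Q₀ := lt_of_lt_of_le (by have := Real.exp_one_gt_d9; linarith) h2
        have : (2 : ℝ) < q₀ := lt_of_lt_of_le h3 hq₀
        exact_mod_cast (show (2 : ℝ) < (q₀ : ℝ) from this)
      obtain ⟨c, hc, hz⟩ := @exists_const_zeroFree q₀ inst₀ (by omega) χ₀ hprim₀ ε'
      refine ⟨c, hc, fun q χ β hE inst σ hσ => ?_⟩
      obtain ⟨inst', hq, hquad, hprim, hzβ, hβ1, hβ⟩ := hE
      -- `(q, χ) = (q₀, χ₀)` by Theorem 1.1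
      have hqq : q = q₀ := by
        by_contra hne
        rcases @hA q q₀ inst inst₀ χ χ₀ hne hq hq₀ hquad hprim hquad₀ hprim₀ β β₀ hzβ hz₀ hβ1 hβ₀1
          with h | h
        · linarith
        · linarith
      subst hqq
      have hχχ : χ = χ₀ := by
        by_contra hne
        rcases @hB q inst χ χ₀ hne hq hquad hprim hquad₀ hprim₀ β β₀ hzβ hz₀ hβ1 hβ₀1 with h | h
        · linarith
        · linarith
      subst hχχ
      exact hz c le_rfl σ hσ
    · refine ⟨1, one_pos, fun q χ β hE => absurd ⟨q, χ, β, hE⟩ hex⟩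
  -- the constant
  refine ⟨min 1 (min c₁ c₂), lt_min one_pos (lt_min hc₁ hc₂), fun q inst χ hq3 hquad hprim σ hσ => ?_⟩
  set c : ℝ := min 1 (min c₁ c₂) with hcdef
  have hc1 : c ≤ 1 := min_le_left _ _
  have hcc₁ : c ≤ c₁ := le_trans (min_le_right _ _) (min_le_left _ _)
  have hcc₂ : c ≤ c₂ := le_trans (min_le_right _ _) (min_le_right _ _)
  have hq1 : (1 : ℝ) < q := by exact_mod_cast (show 1 < q by omega)
  have hlogpos : 0 < Real.log q := Real.log_pos hq1
  have hlog1 : 1 ≤ Real.log q := by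
    have hq3' : (3 : ℝ) ≤ q := by exact_mod_cast hq3
    have hlog3 : 1 < Real.log 3 := by
      rw [Real.lt_log_iff_exp_lt (by norm_num)]
      have := Real.exp_one_lt_d9; linarith
    exact le_trans hlog3.le (Real.log_le_log (by norm_num) hq3')
  -- from `σ ≥ 1 - c (log q)^{-ε}` to `σ ≥ 1 - c (log q)^{-ε'}`
  have hpowle : Real.log q ^ (-ε) ≤ Real.log q ^ (-ε') :=
    Real.rpow_le_rpow_of_exponent_le hlog1 (by linarith)
  have hcpos : 0 < c := lt_min one_pos (lt_min hc₁ hc₂)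
  have hσ' : 1 - c * Real.log q ^ (-ε') ≤ σ := by
    have : c * Real.log q ^ (-ε) ≤ c * Real.log q ^ (-ε') := mul_le_mul_of_nonneg_left hpowle hcpos.le
    linarith
  have hne1 : χ ≠ 1 := ne_one_of_isPrimitive' (by omega) hprim
  have hpow' : 0 ≤ Real.log q ^ (-ε') := Real.rpow_nonneg hlogpos.le _
  rcases lt_or_ge q N with hqN | hqN
  · -- small modulus
    have hmem : q ∈ Finset.Ico 3 N := Finset.mem_Ico.mpr ⟨hq3, hqN⟩
    have : c * Real.log q ^ (-ε') ≤ c₁ * Real.log q ^ (-ε') := mul_le_mul_of_nonneg_right hcc₁ hpow'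
    exact hsmall q hmem inst χ hprim σ (by linarith)
  · -- large modulus: `Q₀ ≤ q`
    have hqQ : Q₀ ≤ q := by
      have : (⌈Q₀⌉₊ : ℝ) ≤ q := by exact_mod_cast (show ⌈Q₀⌉₊ ≤ q by omega)
      exact le_trans (Nat.le_ceil _) this
    rcases le_or_gt 1 σ with h1 | h1
    · exact DirichletCharacter.LFunction_ne_zero_of_one_le_re χ (Or.inl hne1) (by simpa using h1)
    · intro hzero
      -- `(q, χ, σ)` is exceptional
      have hσβ : 1 - Real.log q ^ (-ε') ≤ σ := by
        have : c * Real.log q ^ (-ε') ≤ 1 * Real.log q ^ (-ε') := mul_le_mul_of_nonneg_right hc1 hpow'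
        linarith
      have hE : EXC q χ σ := ⟨inst, hqQ, hquad, hprim, hzero, h1, hσβ⟩
      have : c * Real.log q ^ (-ε') ≤ c₂ * Real.log q ^ (-ε') := mul_le_mul_of_nonneg_right hcc₂ hpow'
      exact hexc q χ σ hE inst σ (by linarith) hzero

/-- **`H_δ` ⇒ `NoSiegelZeros` modulo Theorem 1.1 alone** (Corollary 1.4 being derived above).
[cite: BasakThornerZaharescu2026, Theorem 1.1 and Corollary 1.4] -/
theorem BasakThornerZaharescu2026.LocalRealZeros.noSiegelZeros_of_theorem11
    (h11 : basakThornerZaharescu2026_theorem11) {δ : ℝ} (hδ : 0 < δ) (hδ' : δ < 1 / 10)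
    (hH : LocalRealZeros δ) : NoSiegelZeros :=
  hH.noSiegelZeros (basakThornerZaharescu2026_corollary14_of_theorem11 h11) hδ hδ'

/-! ### Polylog-strength hypotheses of the column are refuted by `H_δ` (appended 2026-08-26,
once the farm had `SiegelZerosLargePrimeGaps` / `SiegelZerosPrimeTuples` built) -/

/-- **`H_δ` refutes Ford's hypothesis `PolylogExceptionalZeros k` for EVERY `k > 0`** (modulo
Corollary 1.4): with `ε = k/2`, a zero at `1 − δ_q`, `δ_q ≤ (log q)^{−k}`, lies inside the
zero-free interval `σ ≥ 1 − c (log q)^{−k/2}` as soon as `(log q)^{−k/2} ≤ c`. So under `H_δ` the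
large-gap mechanism of `SiegelZerosLargePrimeGaps.lean` (and every hypothesis of polylog strength)
has a false antecedent. [cite: BasakThornerZaharescu2026, Corollary 1.4]
[cite: Ford2019LargePrimeGaps, §1, example after Theorem 1.4] -/
theorem BasakThornerZaharescu2026.LocalRealZeros.not_polylogExceptionalZeros
    (h14 : basakThornerZaharescu2026_corollary14) {δ : ℝ} (hδ : 0 < δ) (hδ' : δ < 1 / 10)
    (hH : LocalRealZeros δ) {k : ℝ} (hk : 0 < k) : ¬ Ford2020.PolylogExceptionalZeros k := by
  intro hF
  obtain ⟨c, hc, hzf⟩ := h14 δ hδ hδ' hH (k / 2) (by positivity)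
  -- conductor threshold: `log q ≥ L` with `L^{-k/2} ≤ c`
  set L : ℝ := max 1 (c ^ (-(2 / k))) with hLdef
  have hL1 : 1 ≤ L := le_max_left _ _
  have hLpos : 0 < L := by linarith
  obtain ⟨q, hqne, χ, δ', hq, hprim, hquad, hδ0, _hδ1, hzero, hδk⟩ :=
    hF (⌈Real.exp L⌉₊ + 3)
  have hq3 : 3 ≤ q := by omega
  have hqpos : (0 : ℝ) < q := by exact_mod_cast (show 0 < q by omega)
  -- `log q ≥ L`
  have hlogq : L ≤ Real.log q := by
    have h1 : Real.exp L ≤ q := by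
      have : (⌈Real.exp L⌉₊ : ℝ) ≤ q := by exact_mod_cast (show ⌈Real.exp L⌉₊ ≤ q by omega)
      exact le_trans (Nat.le_ceil _) this
    calc L = Real.log (Real.exp L) := (Real.log_exp L).symm
      _ ≤ Real.log q := Real.log_le_log (Real.exp_pos L) h1
  have hlogpos : 0 < Real.log q := lt_of_lt_of_le hLpos hlogq
  -- `(log q)^{-k/2} ≤ c`
  have hsmall : Real.log q ^ (-(k / 2)) ≤ c := by
    have h1 : Real.log q ^ (-(k / 2)) ≤ L ^ (-(k / 2)) :=
      Real.rpow_le_rpow_of_nonpos hLpos hlogq (by linarith)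
    have h2 : L ^ (-(k / 2)) ≤ (c ^ (-(2 / k))) ^ (-(k / 2)) :=
      Real.rpow_le_rpow_of_nonpos (Real.rpow_pos_of_pos hc _) (le_max_right _ _) (by linarith)
    have h3 : (c ^ (-(2 / k))) ^ (-(k / 2)) = c := by
      rw [← Real.rpow_mul hc.le]
      have : -(2 / k) * -(k / 2) = 1 := by field_simp
      rw [this, Real.rpow_one]
    linarith [h1, h2, h3.le]
  -- the zero `1 - δ'` is inside the zero-free interval
  have hδ'le : δ' ≤ c * Real.log q ^ (-(k / 2)) := by
    have hsplit : Real.log q ^ (-k) = Real.log q ^ (-(k / 2)) * Real.log q ^ (-(k / 2)) := by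
      rw [← Real.rpow_add hlogpos]; ring_nf
    calc δ' ≤ Real.log q ^ (-k) := hδk
      _ = Real.log q ^ (-(k / 2)) * Real.log q ^ (-(k / 2)) := hsplit
      _ ≤ c * Real.log q ^ (-(k / 2)) :=
          mul_le_mul_of_nonneg_right hsmall (Real.rpow_nonneg hlogpos.le _)
  have hσ : 1 - c * Real.log q ^ (-(k / 2)) ≤ 1 - δ' := by linarith
  have hne := hzf q χ hq3 hquad hprim (1 - δ') hσ
  apply hne
  have hcast : (((1 - δ' : ℝ) : ℂ)) = 1 - (δ' : ℂ) := by push_cast; ring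
  rw [hcast]
  exact hzero

/-- **`H_δ` refutes Wright's hypothesis `StrongSiegelZeros A` for every `A ≥ 0`** (modulo
Corollary 1.4, `ε = 1/2`): a real zero `β > 1 − (log D)^{−(r^r+A)}` lies in the zero-free interval
`σ ≥ 1 − c (log D)^{−1/2}` once `(log D)^{r^r+A−1/2} ≥ 1/c`. So the prime-tuple mechanism of
`SiegelZerosPrimeTuples.lean` has a false antecedent under `H_δ`.
[cite: BasakThornerZaharescu2026, Corollary 1.4] [cite: Wright2023PrimeTuplesSiegel, §3 Main Result] -/
theorem BasakThornerZaharescu2026.LocalRealZeros.not_strongSiegelZeros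
    (h14 : basakThornerZaharescu2026_corollary14) {δ : ℝ} (hδ : 0 < δ) (hδ' : δ < 1 / 10)
    (hH : LocalRealZeros δ) {A : ℝ} (hA : 0 ≤ A) : ¬ WrightPrimeTuples.StrongSiegelZeros A := by
  intro hW
  obtain ⟨c, hc, hzf⟩ := h14 δ hδ hδ' hH (1 / 2) (by norm_num)
  set N : ℝ := (FI2003.r : ℝ) ^ FI2003.r + A - 1 / 2 with hNdef
  have hN : 0 < N := by have := FI2003.one_le_r_pow_r; rw [hNdef]; linarith
  set L : ℝ := max 1 ((1 / c) ^ (1 / N)) with hLdef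
  have hL1 : 1 ≤ L := le_max_left _ _
  have hLpos : 0 < L := by linarith
  obtain ⟨D, instD, χ, β, hD, hprim, hquad, _hne, hzero, hβ⟩ := hW (⌈Real.exp L⌉₊ + 3)
  haveI := instD
  have hD3 : 3 ≤ D := by omega
  have hlogD : L ≤ Real.log D := by
    have h1 : Real.exp L ≤ D := by
      have : (⌈Real.exp L⌉₊ : ℝ) ≤ D := by exact_mod_cast (show ⌈Real.exp L⌉₊ ≤ D by omega)
      exact le_trans (Nat.le_ceil _) this
    calc L = Real.log (Real.exp L) := (Real.log_exp L).symm
      _ ≤ Real.log D := Real.log_le_log (Real.exp_pos L) h1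
  have hlogpos : 0 < Real.log D := lt_of_lt_of_le hLpos hlogD
  -- `(log D)^N ≥ 1/c`
  have hpow : 1 / c ≤ Real.log D ^ N := by
    have h0 : 0 ≤ 1 / c := by positivity
    calc 1 / c = ((1 / c) ^ (1 / N)) ^ N := by
          rw [← Real.rpow_mul h0, one_div_mul_cancel hN.ne', Real.rpow_one]
      _ ≤ L ^ N := Real.rpow_le_rpow (Real.rpow_nonneg h0 _) (le_max_right _ _) hN.le
      _ ≤ Real.log D ^ N := Real.rpow_le_rpow hLpos.le hlogD hN.le
  -- `(log D)^{-(r^r+A)} ≤ c (log D)^{-1/2}`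
  have hNle : Real.log D ^ (-N) ≤ c := by
    rw [Real.rpow_neg hlogpos.le, inv_le_comm₀ (Real.rpow_pos_of_pos hlogpos N) hc, inv_eq_one_div]
    exact hpow
  have hkey : Real.log D ^ (-((FI2003.r : ℝ) ^ FI2003.r + A)) ≤ c * Real.log D ^ (-(1 / 2 : ℝ)) := by
    have hexp : -((FI2003.r : ℝ) ^ FI2003.r + A) = -N + -(1 / 2 : ℝ) := by rw [hNdef]; ring
    rw [hexp, Real.rpow_add hlogpos]
    exact mul_le_mul_of_nonneg_right hNle (Real.rpow_nonneg hlogpos.le _)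
  have hβ' : 1 - c * Real.log D ^ (-(1 / 2 : ℝ)) ≤ β := by
    have h1 : 1 / Real.log D ^ ((FI2003.r : ℝ) ^ FI2003.r + A) =
        Real.log D ^ (-((FI2003.r : ℝ) ^ FI2003.r + A)) := by
      rw [Real.rpow_neg hlogpos.le, one_div]
    rw [h1] at hβ
    linarith
  exact hzf D χ hD3 hquad hprim β hβ' hzero

end Literature.NumberTheory.LFunctions

end
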